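import Mathlib.Analysis.SpecialFunctions.Trigonometric.Arctan
import Mathlib.Analysis.SpecialFunctions.Pow.Real
import Mathlib.Analysis.SpecialFunctions.Sqrt

/-!
# The Fehrenbacher–Rice `pfσ*` band of `R`Ba₂Cu₃O₇: exact cube-vertex geometry, the nonorthogonality
# dispersion, the `pdπ` partner bands and the tilt-angle law — as printed by Mazin (1999)

In the `R`-123 cuprates the rare earth `R` sits at the centre of «a nearly perfect cube» whose eight
vertices are the plane oxygens; the `4f` orbital with lobes along `[±1, ±1, ±1]` (`f_{xyz}` in the cube
frame, `f_{(x²−y²)z}` in the Cu–O-bond frame) hybridises (`pfσ`) with the oxygen `2p` orbitals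
PERPENDICULAR to the Cu–O bonds and forms an antibonding «`pfσ*`» state which, if high enough, «will
pull some holes out of» the superconducting `pdσ*` band — the Fehrenbacher–Rice (FR) mechanism for the
absence of superconductivity in PrBa₂Cu₃O₇ [FehrenbacherRice1993], made itinerant by Liechtenstein–
Mazin's LDA+`U` calculation [LiechtensteinMazin1995].  Mazin's 1999 note [Mazin1999] (arXiv:cond-mat/
9806246, pp. 3–5 of the materialised text) prints the EXACT one-body content of the corrected FR model,
which this file types and proves:

* §1 GEOMETRY.  The `R`–O bond makes with the CuO₂ plane the angle `φ = arctan(1/√2) ≈ 35°16′`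
  (half the cube edge over half the face diagonal), NOT FR's `45°`; hence `tan²φ = 1/2`,
  `cos²φ = 2/3`, `sin²φ = 1/3` and `cos 2φ = 1/3` exactly (`frAngle_*`).  With FR's `45°` one gets
  `cos 2φ = 0` (`cos_two_mul_pi_div_four`).
* §2 HOPPING GEOMETRY AND THE IMPURITY SHIFT.  The `pfσ` amplitude `t_pf` enters through
  `t₁₂ = t₁₃ = √(5/27)·t_pf` (to O `p_z`) and `t₁₄ = t₁₅ = √(10/27)·t_pf = √2·t₁₂` (to the in-plane
  `pπ`); per oxygen `t₁₂² + t₁₄² = (5/9)·t_pf²`, so the isolated-Pr antibonding shift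
  `δε = (5/9)·8t_pf²/(E_p − E_f)` [Mazin1999, Eq. (1)] is `8·(t₁₂² + t₁₄²)/(E_p − E_f)`
  (`frShift_eq_sum_sq`).
* §3 THE FR BAND (all `R` sites Pr, `t_pdπ = 0`): `ε_k − E_p = δε − δε·cos 2φ·(cos ak_x + cos bk_y)/2`
  [Mazin1999, Eq. (2)] — «dispersion due to nonorthogonality».  Its value is `δε(1 − cos 2φ)` at `Γ`
  and `δε(1 + cos 2φ)` at `(π,π)`; for `δε ≥ 0`, `cos 2φ ≥ 0` the band lies between those two values
  for every `k` (`frBand_le_corner`, `frBand_ge_centre`): the TOP is at `(π,π)` «and that is where the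
  holes go», the peak-to-peak range is `2δε·cos 2φ` — `2δε/3` at the true angle (`frBand_range_true`)
  and ZERO at FR's `45°` («dispersionless and thus fully localized», `frBand_flat_of_fortyfive`).  The
  printed «`W = δε cos 2φ = δε/3`» is the hopping-scale (half-range) of this dispersion
  (`frBand_halfRange_true`); both numbers are recorded, neither is asserted to be the other.
* §4 THE `pdπ` PARTNER BANDS (no `f`, `E_d = E_p`): the three antibonding bands
  `2t sin(ak_x/2)`, `2t sin(bk_y/2)`, `2t√(sin²(ak_x/2) + sin²(bk_y/2))` [Mazin1999, Eqs. (3)–(5)]: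
  the third is the Pythagorean combination of the first two (`pdpiBand3_sq`), is bounded by `2√2·t`
  for `t ≥ 0` and attains it at `(π,π)` (`pdpiBand3_le`, `pdpiBand3_corner`) — «the top of the highest
  (third) band is again at (π,π)».
* §5 THE TILT-ANGLE LAW.  At Pr concentration `x` an oxygen has one Pr neighbour with probability
  `ν₁ = 2x(1−x)` and two with `ν₂ = x²`; the average `p_z` character of the FR holes is
  `sin²α = ν₁ sin²φ/(ν₁ + ν₂) = (2/3)(1 − x)/(2 − x)` for `0 < x`, `x ≠ 2` (`tiltSinSq_eq`); at
  `x = 4/5` this is `1/9`, i.e. `sin α = 1/3`, `α ≈ 19.47°` — the printed «≈ 19.5°» against NEXAFS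
  `20–25°` (`tiltSinSq_four_fifths`); the closed form tends to `sin²φ = 1/3` (`α → φ ≈ 36°`) as
  `x → 0` (`tiltClosedForm_zero`) and decreases in `x` on `[0, 2)` (`tiltClosedForm_antitone`).

Everything is PROVED; no named facts, no axioms beyond Mathlib's, no `sorry`.  NOT here: any value of
`t_pf`, `t_pdπ`, `E_p − E_f`, `U_f`, or hole count (none is printed in [Mazin1999]); the combined
`pfσ + pdπ` band («cannot be solved analytically»); whether the `pfσ*` band reaches the Fermi level in
PrBa₂Cu₃O₇ (a material statement).  Lattice constants are scaled out (`a k_x ↦ kx`, `b k_y ↦ ky`).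

References: I. I. Mazin, *Theoretical possibilities for superconductivity in PrBa₂Cu₃O₇*, Phys. Rev.
B 60 (1999) 92–95, arXiv:cond-mat/9806246, Eqs. (1)–(5) and pp. 3–5; R. Fehrenbacher, T. M. Rice,
Phys. Rev. Lett. 70 (1993) 3471; A. I. Liechtenstein, I. I. Mazin, Phys. Rev. Lett. 74 (1995) 1000
(the two primaries are quoted through Mazin 1999 only).  AI-produced formalisation (H21, cell
hubbard-downfold, seat lit-1, 2026-08-27).
-/

noncomputable section

namespace Literature.MathematicalPhysics.QuantumLattice

namespace FehrenbacherRice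

open Real

/-! ## §1 The cube-vertex angle `φ = arctan(1/√2)` and `cos 2φ = 1/3` -/

/-- The angle the `R`–O bond makes with the CuO₂ plane when `R` is at the centre of the oxygen cube:
`φ = arctan(1/√2)` («not 45°, but tan⁻¹(1/√2) ≈ 35°16′»). [cite: Mazin1999, p. 3 (arXiv p0003 L68-71)] -/
def frAngle : ℝ := arctan (1 / sqrt 2)

/-- Unfolding. [cite: Mazin1999, p. 3] -/
theorem frAngle_def : frAngle = arctan (1 / sqrt 2) := rfl

/-- `tan φ = 1/√2`. [cite: Mazin1999, p. 3] -/
theorem tan_frAngle : tan frAngle = 1 / sqrt 2 := by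
  rw [frAngle_def, tan_arctan]

/-- `tan²φ = 1/2`. [cite: Mazin1999, p. 3] -/
theorem tan_frAngle_sq : tan frAngle ^ 2 = 1 / 2 := by
  rw [tan_frAngle, div_pow, one_pow, sq_sqrt (by norm_num : (0:ℝ) ≤ 2)]

/-- `cos²φ = 2/3` (from `cos(arctan x) = 1/√(1+x²)`). [cite: Mazin1999, p. 3] -/
theorem cos_frAngle_sq : cos frAngle ^ 2 = 2 / 3 := by
  rw [frAngle_def, cos_arctan, div_pow, one_pow]
  have h2 : (1 / sqrt 2 : ℝ) ^ 2 = 1 / 2 := by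
    rw [div_pow, one_pow, sq_sqrt (by norm_num : (0:ℝ) ≤ 2)]
  have hpos : (0:ℝ) ≤ 1 + (1 / sqrt 2) ^ 2 := by positivity
  rw [sq_sqrt hpos, h2]
  norm_num

/-- `sin²φ = 1/3` — the `p_z` weight of an oxygen orbital pointing at a single Pr neighbour.
[cite: Mazin1999, p. 5 (arXiv p0005 L7-8)] -/
theorem sin_frAngle_sq : sin frAngle ^ 2 = 1 / 3 := by
  have h := sin_sq_add_cos_sq frAngle
  rw [cos_frAngle_sq] at h
  linarith

/-- `cos 2φ = 1/3` exactly — the factor that makes the FR band disperse even without O–O hopping.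
[cite: Mazin1999, Eq. (2) and p. 4 («W = δε cos 2φ = δε/3»)] -/
theorem cos_two_frAngle : cos (2 * frAngle) = 1 / 3 := by
  rw [cos_two_mul, cos_frAngle_sq]
  norm_num

/-- `0 < φ`. [cite: Mazin1999, p. 3] -/
theorem frAngle_pos : 0 < frAngle := by
  rw [frAngle_def]
  exact arctan_pos.mpr (by positivity)

/-- `φ < π/4`: the true angle is SMALLER than FR's assumed `45°` (since `1/√2 < 1 = tan(π/4)`).
[cite: Mazin1999, p. 3] -/
theorem frAngle_lt_pi_div_four : frAngle < π / 4 := by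
  rw [frAngle_def, ← arctan_one]
  apply arctan_strictMono
  rw [div_lt_one (sqrt_pos.mpr (by norm_num : (0:ℝ) < 2))]
  have h : sqrt 1 < sqrt 2 := sqrt_lt_sqrt (by norm_num) (by norm_num)
  rwa [sqrt_one] at h

/-- FR's assumed `45°` bond angle gives `cos 2φ = 0` — a dispersionless `pfσ*` band.
[cite: Mazin1999, p. 4 («Had this angle been 45°, as assumed by FR, the band would be dispersionless»)] -/
theorem cos_two_mul_pi_div_four : cos (2 * (π / 4)) = 0 := by
  rw [show 2 * (π / 4) = π / 2 by ring, cos_pi_div_two]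

/-! ## §2 Hopping geometry `t₁₂ = √(5/27) t_pf`, `t₁₄ = √(10/27) t_pf` and the impurity shift -/

/-- Pr-`f_{z(x²−y²)}` to O-`p_z` hopping: `t₁₂ = t₁₃ = √(5/27)·t_pf`. [cite: Mazin1999, p. 4 (arXiv p0004 L12-13)] -/
def t12 (tpf : ℝ) : ℝ := sqrt (5 / 27) * tpf

/-- Pr-`f_{z(x²−y²)}` to in-plane O-`pπ` hopping: `t₁₄ = t₁₅ = √(10/27)·t_pf`. [cite: Mazin1999, p. 4] -/
def t14 (tpf : ℝ) : ℝ := sqrt (10 / 27) * tpf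

/-- Unfolding. [cite: Mazin1999, p. 4] -/
theorem t12_def (tpf : ℝ) : t12 tpf = sqrt (5 / 27) * tpf := rfl

/-- Unfolding. [cite: Mazin1999, p. 4] -/
theorem t14_def (tpf : ℝ) : t14 tpf = sqrt (10 / 27) * tpf := rfl

/-- `t₁₄ = √2·t₁₂` as printed. [cite: Mazin1999, p. 4 («t₁₄ = t₁₅ = √(10/27) t_pf = √2 t₁₂»)] -/
theorem t14_eq_sqrt_two_mul_t12 (tpf : ℝ) : t14 tpf = sqrt 2 * t12 tpf := by
  rw [t14_def, t12_def, ← mul_assoc, ← sqrt_mul (by norm_num : (0:ℝ) ≤ 2)]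
  norm_num

/-- `t₁₂² = (5/27) t_pf²`. [cite: Mazin1999, p. 4] -/
theorem t12_sq (tpf : ℝ) : t12 tpf ^ 2 = 5 / 27 * tpf ^ 2 := by
  rw [t12_def, mul_pow, sq_sqrt (by norm_num : (0:ℝ) ≤ 5 / 27)]

/-- `t₁₄² = (10/27) t_pf²`. [cite: Mazin1999, p. 4] -/
theorem t14_sq (tpf : ℝ) : t14 tpf ^ 2 = 10 / 27 * tpf ^ 2 := by
  rw [t14_def, mul_pow, sq_sqrt (by norm_num : (0:ℝ) ≤ 10 / 27)]

/-- Per oxygen the squared `f`–`p` couplings add up to `(5/9)·t_pf²` — the «5/9» of the impurity shift.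
[cite: Mazin1999, Eq. (1)] -/
theorem t12_sq_add_t14_sq (tpf : ℝ) : t12 tpf ^ 2 + t14 tpf ^ 2 = 5 / 9 * tpf ^ 2 := by
  rw [t12_sq, t14_sq]; ring

/-- The isolated-Pr antibonding shift of the `pfσ*` level above the bare O-`p` level:
`δε = (5/9)·8t_pf²/(E_p − E_f)` («8 stands for the eight neighboring oxygens»; `t_pf ≪ E_p − E_f` assumed
in the source). Arguments: `tpf`, `gap = E_p − E_f`. [cite: Mazin1999, Eq. (1)] -/
def frShift (tpf gap : ℝ) : ℝ := 5 / 9 * (8 * tpf ^ 2 / gap)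

/-- Unfolding. [cite: Mazin1999, Eq. (1)] -/
theorem frShift_def (tpf gap : ℝ) : frShift tpf gap = 5 / 9 * (8 * tpf ^ 2 / gap) := rfl

/-- The impurity shift is eight times the per-oxygen second-order shift `(t₁₂² + t₁₄²)/(E_p − E_f)`.
[cite: Mazin1999, Eq. (1) with p. 4] -/
theorem frShift_eq_sum_sq (tpf gap : ℝ) :
    frShift tpf gap = 8 * (t12 tpf ^ 2 + t14 tpf ^ 2) / gap := by
  rw [frShift_def, t12_sq_add_t14_sq]; ring

/-- `δε ≥ 0` when the `f` level lies below the `p` level (`E_p − E_f > 0`). [cite: Mazin1999, Eq. (1)] -/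
theorem frShift_nonneg (tpf : ℝ) {gap : ℝ} (hgap : 0 < gap) : 0 ≤ frShift tpf gap := by
  rw [frShift_def]; positivity

/-! ## §3 The FR band `ε_k − E_p = δε − δε·cos 2φ·(cos k_x + cos k_y)/2` -/

/-- The FR `pfσ*` band (all `R` sites Pr, `t_pdπ = 0`), measured from the bare O-`p` level, as a function
of the shift `δε`, the geometric factor `c = cos 2φ` and the (scaled) momenta:
`δε − δε·c·(cos kx + cos ky)/2`. [cite: Mazin1999, Eq. (2)] -/
def frBand (δε c kx ky : ℝ) : ℝ := δε - δε * c * ((cos kx + cos ky) / 2)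

/-- Unfolding. [cite: Mazin1999, Eq. (2)] -/
theorem frBand_def (δε c kx ky : ℝ) :
    frBand δε c kx ky = δε - δε * c * ((cos kx + cos ky) / 2) := rfl

/-- Zone centre: `ε_Γ − E_p = δε(1 − cos 2φ)`. [cite: Mazin1999, Eq. (2)] -/
theorem frBand_centre (δε c : ℝ) : frBand δε c 0 0 = δε * (1 - c) := by
  rw [frBand_def, cos_zero]; ring

/-- Zone corner: `ε_(π,π) − E_p = δε(1 + cos 2φ)`. [cite: Mazin1999, Eq. (2) and p. 4] -/
theorem frBand_corner (δε c : ℝ) : frBand δε c π π = δε * (1 + c) := by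
  rw [frBand_def, cos_pi]; ring

/-- The band never exceeds its `(π,π)` value when `δε ≥ 0`, `cos 2φ ≥ 0`: «the top of the band occurs at
the (π,π) point and that is where the holes go». [cite: Mazin1999, p. 4 (arXiv p0004 L48-50)] -/
theorem frBand_le_corner {δε c : ℝ} (hδ : 0 ≤ δε) (hc : 0 ≤ c) (kx ky : ℝ) :
    frBand δε c kx ky ≤ frBand δε c π π := by
  rw [frBand_corner, frBand_def]
  have h1 : -1 ≤ cos kx := neg_one_le_cos kx
  have h2 : -1 ≤ cos ky := neg_one_le_cos ky
  have hdc : 0 ≤ δε * c := mul_nonneg hδ hc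
  nlinarith

/-- … and is never below its `Γ` value. [cite: Mazin1999, Eq. (2)] -/
theorem frBand_ge_centre {δε c : ℝ} (hδ : 0 ≤ δε) (hc : 0 ≤ c) (kx ky : ℝ) :
    frBand δε c 0 0 ≤ frBand δε c kx ky := by
  rw [frBand_centre, frBand_def]
  have h1 : cos kx ≤ 1 := cos_le_one kx
  have h2 : cos ky ≤ 1 := cos_le_one ky
  have hdc : 0 ≤ δε * c := mul_nonneg hδ hc
  nlinarith

/-- Peak-to-peak range of the FR band: `ε_(π,π) − ε_Γ = 2δε·cos 2φ`. [cite: Mazin1999, Eq. (2)] -/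
theorem frBand_range (δε c : ℝ) : frBand δε c π π - frBand δε c 0 0 = 2 * δε * c := by
  rw [frBand_corner, frBand_centre]; ring

/-- At the true angle (`cos 2φ = 1/3`): `ε_Γ − E_p = 2δε/3`. [cite: Mazin1999, Eq. (2)] -/
theorem frBand_centre_true (δε : ℝ) : frBand δε (cos (2 * frAngle)) 0 0 = 2 / 3 * δε := by
  rw [frBand_centre, cos_two_frAngle]; ring

/-- At the true angle: `ε_(π,π) − E_p = 4δε/3`. [cite: Mazin1999, Eq. (2)] -/
theorem frBand_corner_true (δε : ℝ) : frBand δε (cos (2 * frAngle)) π π = 4 / 3 * δε := by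
  rw [frBand_corner, cos_two_frAngle]; ring

/-- At the true angle the peak-to-peak range is `2δε/3`. [cite: Mazin1999, Eq. (2)] -/
theorem frBand_range_true (δε : ℝ) :
    frBand δε (cos (2 * frAngle)) π π - frBand δε (cos (2 * frAngle)) 0 0 = 2 / 3 * δε := by
  rw [frBand_range, cos_two_frAngle]; ring

/-- The printed bandwidth scale «`W = δε cos 2φ = δε/3`» is HALF the peak-to-peak range of Eq. (2)
(the hopping scale of the dispersion). Both numbers recorded; the source's `W` is quoted as printed.
[cite: Mazin1999, p. 4 (arXiv p0004 L44-45)] -/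
theorem frBand_halfRange_true (δε : ℝ) :
    (frBand δε (cos (2 * frAngle)) π π - frBand δε (cos (2 * frAngle)) 0 0) / 2 = δε / 3 ∧
      δε * cos (2 * frAngle) = δε / 3 := by
  rw [frBand_range_true, cos_two_frAngle]
  constructor <;> ring

/-- With FR's `45°` (`cos 2φ = 0`) the band is FLAT at `δε` for every `k` — «dispersionless and thus fully
localized». [cite: Mazin1999, p. 4] -/
theorem frBand_flat_of_fortyfive (δε kx ky : ℝ) : frBand δε (cos (2 * (π / 4))) kx ky = δε := by
  rw [cos_two_mul_pi_div_four, frBand_def]; ring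

/-! ## §4 The `pdπ` partner bands (no `f`, `E_d = E_p`) -/

/-- First `pdπ` antibonding band `2t sin(kx/2)`. [cite: Mazin1999, Eq. (3)] -/
def pdpiBand1 (t kx : ℝ) : ℝ := 2 * t * sin (kx / 2)

/-- Second `pdπ` antibonding band `2t sin(ky/2)`. [cite: Mazin1999, Eq. (4)] -/
def pdpiBand2 (t ky : ℝ) : ℝ := 2 * t * sin (ky / 2)

/-- Third (highest) `pdπ` antibonding band `2t√(sin²(kx/2) + sin²(ky/2))`. [cite: Mazin1999, Eq. (5)] -/
def pdpiBand3 (t kx ky : ℝ) : ℝ := 2 * t * sqrt (sin (kx / 2) ^ 2 + sin (ky / 2) ^ 2)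

/-- Unfolding. [cite: Mazin1999, Eq. (3)] -/
theorem pdpiBand1_def (t kx : ℝ) : pdpiBand1 t kx = 2 * t * sin (kx / 2) := rfl

/-- Unfolding. [cite: Mazin1999, Eq. (4)] -/
theorem pdpiBand2_def (t ky : ℝ) : pdpiBand2 t ky = 2 * t * sin (ky / 2) := rfl

/-- Unfolding. [cite: Mazin1999, Eq. (5)] -/
theorem pdpiBand3_def (t kx ky : ℝ) :
    pdpiBand3 t kx ky = 2 * t * sqrt (sin (kx / 2) ^ 2 + sin (ky / 2) ^ 2) := rfl

/-- The third band is the Pythagorean combination of the first two: `ε₃² = ε₁² + ε₂²`.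
[cite: Mazin1999, Eqs. (3)–(5)] -/
theorem pdpiBand3_sq (t kx ky : ℝ) :
    pdpiBand3 t kx ky ^ 2 = pdpiBand1 t kx ^ 2 + pdpiBand2 t ky ^ 2 := by
  rw [pdpiBand3_def, pdpiBand1_def, pdpiBand2_def, mul_pow, sq_sqrt (by positivity)]
  ring

/-- At the zone corner the third band reaches `2√2·t`. [cite: Mazin1999, p. 4 («The top of the highest
(third) band is again at (π,π)»)] -/
theorem pdpiBand3_corner (t : ℝ) : pdpiBand3 t π π = 2 * sqrt 2 * t := by
  rw [pdpiBand3_def, sin_pi_div_two]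
  norm_num
  ring

/-- For `t ≥ 0` the third band never exceeds its `(π,π)` value `2√2·t`. [cite: Mazin1999, p. 4] -/
theorem pdpiBand3_le {t : ℝ} (ht : 0 ≤ t) (kx ky : ℝ) : pdpiBand3 t kx ky ≤ pdpiBand3 t π π := by
  rw [pdpiBand3_corner, pdpiBand3_def]
  have hs : sqrt (sin (kx / 2) ^ 2 + sin (ky / 2) ^ 2) ≤ sqrt 2 := by
    apply sqrt_le_sqrt
    nlinarith [sin_sq_le_one (kx / 2), sin_sq_le_one (ky / 2)]
  nlinarith [hs, ht]

/-- For `t ≥ 0` the first band is bounded by `2t` (attained at `kx = π`). [cite: Mazin1999, Eq. (3)] -/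
theorem pdpiBand1_le {t : ℝ} (ht : 0 ≤ t) (kx : ℝ) : pdpiBand1 t kx ≤ 2 * t := by
  rw [pdpiBand1_def]
  nlinarith [sin_le_one (kx / 2)]

/-- `ε₁(π) = 2t`. [cite: Mazin1999, Eq. (3)] -/
theorem pdpiBand1_pi (t : ℝ) : pdpiBand1 t π = 2 * t := by
  rw [pdpiBand1_def, sin_pi_div_two, mul_one]

/-! ## §5 The tilt-angle law `sin²α = (2/3)(1 − x)/(2 − x)` -/

/-- Probability that a plane oxygen has exactly ONE Pr neighbour at Pr concentration `x` (two `R` sites per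
oxygen): `ν₁ = 2x(1 − x)`. [cite: Mazin1999, p. 5 (arXiv p0005 L4-5)] -/
def nu1 (x : ℝ) : ℝ := 2 * x * (1 - x)

/-- Probability of TWO Pr neighbours: `ν₂ = x²`. [cite: Mazin1999, p. 5] -/
def nu2 (x : ℝ) : ℝ := x ^ 2

/-- Unfolding. [cite: Mazin1999, p. 5] -/
theorem nu1_def (x : ℝ) : nu1 x = 2 * x * (1 - x) := rfl

/-- Unfolding. [cite: Mazin1999, p. 5] -/
theorem nu2_def (x : ℝ) : nu2 x = x ^ 2 := rfl

/-- Total FR-hole weight `n = ν₁ + ν₂ = x(2 − x)`. [cite: Mazin1999, p. 5 («n = ν₁ + ν₂»)] -/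
theorem nu1_add_nu2 (x : ℝ) : nu1 x + nu2 x = x * (2 - x) := by
  rw [nu1_def, nu2_def]; ring

/-- Average `p_z` character of the FR holes divided by their number: `sin²α = ν₁ sin²φ/(ν₁ + ν₂)` (an oxygen
with Pr on BOTH sides carries no `p_z` character in the highest state). [cite: Mazin1999, p. 5
(arXiv p0005 L1-10)] -/
def tiltSinSq (x : ℝ) : ℝ := nu1 x * sin frAngle ^ 2 / (nu1 x + nu2 x)

/-- Unfolding. [cite: Mazin1999, p. 5] -/
theorem tiltSinSq_def (x : ℝ) : tiltSinSq x = nu1 x * sin frAngle ^ 2 / (nu1 x + nu2 x) := rfl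

/-- The printed closed form `(2/3)(1 − x)/(2 − x)`. [cite: Mazin1999, p. 5 («sin²α = (2/3)(1−x)/(2−x)»)] -/
def tiltClosedForm (x : ℝ) : ℝ := 2 / 3 * ((1 - x) / (2 - x))

/-- Unfolding. [cite: Mazin1999, p. 5] -/
theorem tiltClosedForm_def (x : ℝ) : tiltClosedForm x = 2 / 3 * ((1 - x) / (2 - x)) := rfl

/-- The tilt-angle law: for `x ≠ 0`, `x ≠ 2`, `sin²α = (2/3)(1 − x)/(2 − x)`. [cite: Mazin1999, p. 5] -/
theorem tiltSinSq_eq {x : ℝ} (hx : x ≠ 0) (hx2 : x ≠ 2) : tiltSinSq x = tiltClosedForm x := by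
  rw [tiltSinSq_def, tiltClosedForm_def, nu1_add_nu2, nu1_def, sin_frAngle_sq]
  have h2x : (2 - x) ≠ 0 := sub_ne_zero.mpr (Ne.symm hx2)
  field_simp

/-- At `x = 4/5` (80 % Pr): `sin²α = 1/9`, i.e. `sin α = 1/3`, `α ≈ 19.47°` — the printed «≈ 19.5°, in
excellent agreement with the experiment» (NEXAFS: 20–25° at 80 % Pr). [cite: Mazin1999, p. 5
(arXiv p0005 L11-12)] -/
theorem tiltSinSq_four_fifths : tiltSinSq (4 / 5) = 1 / 9 := by
  rw [tiltSinSq_eq (by norm_num) (by norm_num), tiltClosedForm_def]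
  norm_num

/-- `(1/3)² = 1/9`: the `x = 4/5` value is the square of `sin α = 1/3`. [cite: Mazin1999, p. 5] -/
theorem one_third_sq : (1 / 3 : ℝ) ^ 2 = 1 / 9 := by norm_num

/-- The closed form at `x = 0` equals `sin²φ = 1/3`: in the dilute limit the tilt tends to the single-Pr
geometric angle `φ ≈ 36°` («in the FR model it increases up to α = φ ≈ 36°»). [cite: Mazin1999, p. 5
(arXiv p0005 L18-20)] -/
theorem tiltClosedForm_zero : tiltClosedForm 0 = sin frAngle ^ 2 := by
  rw [tiltClosedForm_def, sin_frAngle_sq]; norm_num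

/-- The closed form at `x = 1` is `0` (its formal full-Pr limit; the source notes that band dispersion
takes over at large `x` and the FR value there must coincide with LM's ≈ 20°). [cite: Mazin1999, p. 5] -/
theorem tiltClosedForm_one : tiltClosedForm 1 = 0 := by
  rw [tiltClosedForm_def]; norm_num

/-- `(1 − x)/(2 − x) = 1 − 1/(2 − x)`: the closed form DECREASES with `x` on `x < 2` («they predict the
opposite dependences: … in the FR model it increases» as `x` DEcreases). [cite: Mazin1999, p. 5] -/
theorem tiltClosedForm_antitone {x y : ℝ} (hxy : x ≤ y) (hy : y < 2) :
    tiltClosedForm y ≤ tiltClosedForm x := by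
  rw [tiltClosedForm_def, tiltClosedForm_def]
  have hx2 : 0 < 2 - x := by linarith
  have hy2 : 0 < 2 - y := by linarith
  have key : (1 - y) / (2 - y) ≤ (1 - x) / (2 - x) := by
    rw [div_le_div_iff₀ hy2 hx2]
    nlinarith
  linarith

end FehrenbacherRice

end Literature.MathematicalPhysics.QuantumLattice

end
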